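import Literature.AlgebraicGeometry.Resolution.AlterationsFibrationReductionZariski
import Literature.AlgebraicGeometry.Resolution.AlterationsLemma411Vertex
import Literature.AlgebraicGeometry.Resolution.Lemma411VertexChoiceHolds
import Literature.AlgebraicGeometry.Resolution.AlterationsLemma411VertexBlowupHolds
import HarnessLib

/-!
# Discharged facts: de Jong 1996, Lemma 4.11 (generic-projection form) and the fibration reduction
# step of Thm. 4.1 hold

Two named facts of the alterations cluster (A. J. de Jong, *Smoothness, semi-stability and
alterations*, Publ. Math. IHÉS 83 (1996), §4) were reduced in the tree to leaves that are all
theorems now: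

* `DeJong1996Lemma411GenericProjection` (`AlterationsLemma411Projection`: Lemma 4.11 in its
  generic-projection form) ← the vertex choice `DeJong1996Lemma411VertexChoice_holds`
  (`Lemma411VertexChoiceHolds`) and the blow-up projection `DeJong1996VertexBlowupProjection_holds`
  (`AlterationsLemma411VertexBlowupHolds`), by
  `DeJong1996Lemma411GenericProjection.of_vertexBlowupProjection_of_vertexChoice`
  (`AlterationsLemma411Vertex`);
* `DeJong1996FibrationReduction` (`AlterationsFibrations`: the reduction of Thm. 4.1 to a
  Lemma-4.11 fibration, 4.11–4.12) ← `DeJong1996Lemma411VertexChoice_holds`, by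
  `DeJong1996FibrationReduction.of_vertexChoice` (`AlterationsFibrationReductionZariski`).

(The companions `DeJong1996Lemma411` and `DeJong1996FibresGeometricallyConnected` are already theorems
of the tree under the names `Literature.AlgebraicGeometry.Motives.dejong_lemma411` and
`….dejong_fibresGeometricallyConnected`, `Motives/CurveNetFromLemma411`, and are not restated here.)
One-line applications; no statement is changed; no definition, no new named fact (D-0026); net
Literature debt **−2**.

## References

* A. J. de Jong, *Smoothness, semi-stability and alterations*, Publ. Math. IHÉS 83 (1996) 51–93:
  4.11–4.12 (pp. 67–69). [DeJong1996]
-/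

namespace Literature.AlgebraicGeometry.Resolution

universe u

/-- **de Jong 1996, Lemma 4.11, generic-projection form — the named fact
`DeJong1996Lemma411GenericProjection` holds**
(`DeJong1996Lemma411GenericProjection.of_vertexBlowupProjection_of_vertexChoice` applied to
`DeJong1996VertexBlowupProjection_holds` and `DeJong1996Lemma411VertexChoice_holds`).
[cite: DeJong1996, Lemma 4.11 (proof), p. 68] -/
theorem DeJong1996Lemma411GenericProjection_holds : DeJong1996Lemma411GenericProjection.{u} :=
  DeJong1996Lemma411GenericProjection.of_vertexBlowupProjection_of_vertexChoice
    DeJong1996VertexBlowupProjection_holds DeJong1996Lemma411VertexChoice_holds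

/-- **de Jong 1996, 4.11–4.12: the reduction of Thm. 4.1 to a Lemma-4.11 fibration — the named fact
`DeJong1996FibrationReduction` holds** (`DeJong1996FibrationReduction.of_vertexChoice` applied to
`DeJong1996Lemma411VertexChoice_holds`). [cite: DeJong1996, Lemma 4.11 and 4.12, pp. 67–69] -/
theorem DeJong1996FibrationReduction_holds : DeJong1996FibrationReduction.{u} :=
  DeJong1996FibrationReduction.of_vertexChoice DeJong1996Lemma411VertexChoice_holds

end Literature.AlgebraicGeometry.Resolution
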